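import Literature.Probability.RandomPlanarGeometry.HexSAWStripWidthTwoHatRecursion
import Literature.Analysis.Asymptotics.LinearRecurrenceDominantRoot
import HarnessLib

/-!
# The width-two strip: spectral decomposition `G(y₂) = P + N` of the hat transfer matrix and GEOMETRIC convergence of the hat bridge sums,
# `D̂(k) = A + N^k(1 + M̂(0))`, `|D̂(k)_{ab} − A_{ab}| = O(k·R^k)` with `R = 1/√(6+5√2)` and `A` explicit (module «WIDTH-TWO HAT CONVERGENCE»)

Topic `Literature/Probability/RandomPlanarGeometry` (continues «WIDTH-TWO HAT RECURSION» `HexSAWStripWidthTwoHatRecursion.lean` — `W2.gTwo`, `W2.hatD_two_succ`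
(`D̂(k+1) = G·D̂(k)`), `W2.gTwo_mulVec_uTwo`, `W2.hatMZeroTwo_mul_self` —, «WIDTH-TWO-KERNEL» #715 (`W2.uTwo`, `W2.ellTwo`, `W2.xc_minpoly`, `W2.seven_mul_stripYT_two`),
and a-p5's «LINEAR RECURRENCE DEFLATION / DOMINANT ROOT» `Literature/Analysis/Asymptotics/LinearRecurrence{Deflation,DominantRoot}.lean`
(`abs_le_of_rec_two`, `tendsto_zero_of_rec_two_of_lt_one`, `quadRootBound`, `norm_le_quadRootBound`)).  Lane «pcv-sawmu» (CriticalPhenomena venture),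
a-p2 g26 — CAR V-B part 2 of the variance-rate design (`HOME/pub-sawmu-a-p2/g26/DESIGN-VARIANCE-RATE-T2.md` §4).  At the critical surface fugacity `y₂` the
4×4 matrix `G` has the simple eigenvalue `1` with right/left eigenvectors `uTwo`, `w = ellTwo·(1 − M̂(0))`, the eigenvalue `0`, and a complex pair of modulus
`1/√(6+5√2) = 0.2766`; we write `G = P + N` with the explicit rank-one projection `P = uTwo ⊗ w/(w·uTwo)` (entries in `ℚ(x_c)`, e.g. `P₀₁ = x − 2x³`,
`P₂₂ = 2x² − ½`), prove `P² = P`, `GP = PG = P`, `G³ + pG² + κG = (1+p+κ)P` with `p = −(1+x²)/7`, `κ = (2−5x²)/7` (the subdominant quadratic `λ² + pλ + κ`;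
`p² − 4κ < 0`), hence `N³ + pN² + κN = 0`, `G^k = P + N^k`, and with `D̂(k) = G^k(1 + M̂(0))` the DECOMPOSITION `D̂(k) = A + N^k(1 + M̂(0))`, `A = P(1 + M̂(0))`
EXPLICIT (`A₀₀ = 1 − 3x² = 0.12132…`, `A₀₃ = x`, `A₂₂ = ½ + x²`, …); a-p5's deflation bound turns the order-two recurrence of `k ↦ (N^k(1+M̂(0)))_{ab}` into the
geometric estimate.  All matrix identities are `linear_combination` certificates modulo `2x⁴ − 4x² + 1 = 0` and `7y₂ = 26 − 16x²` (kit `g26/hat2b/gen_hat2b.py`).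
Sources of the SETTING: H. Duminil-Copin, A. Hammond, CMP 324 (2013) §2.2; W. Feller I (1968) XIII.3, XIII.10 (renewal theorem with geometric rate for
finite support); R. P. Stanley, EC1 (2012) §4.1 Thm 4.1.1 (iii); E. Seneta (1973) §1.4.  Nothing below is printed.

## What is proved (namespace `…SAW.HV.W2`; `y₂ = stripYT 2`, `x = x_c`)

* `hatD_two_zero : D̂(0) = M̂(0)`, `hatD_two_one : D̂(1) = G·(1 + M̂(0))`, ★ `hatD_two_eq_pow_mul : D̂(k) = G^k·(1 + M̂(0))` (k ≥ 1; every `y ≥ 0`).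
* `projTwo`, `limTwo`, `pTwo = −(1+x²)/7`, `kTwo = (2−5x²)/7`; ★ `projTwo_mul_self`, `gTwo_mul_projTwo`, `projTwo_mul_gTwo`, ★ `gTwo_cubic_eq_proj`
  (`G³ + pG² + κG = (1+p+κ)P` at `y₂`), `projTwo_mul_one_add` (`P(1+M̂(0)) = limTwo`).
* `nilTwo := G(y₂) − P`; ★ `gTwo_pow_succ_eq : G^(k+1) = P + N^(k+1)`, ★ `nilTwo_cubic : N³ + pN² + κN = 0`;
  ★★★ **`hatD_two_decomp : D̂(k) = limTwo + N^k·(1 + M̂(0))`** (k ≥ 1) — the hat bridge sums of `S₂` at criticality are an EXPLICIT constant matrix plus a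
  geometrically small term; `nil_seq_rec` (the order-two recurrence of `k ↦ (N^(k+1)(1+M̂(0)))_{ab}`).
* `rTwo := quadRootBound pTwo kTwo`, `pTwo_sq_lt`, ★ `rTwo_lt_one`; ★★★ **`hatD_two_geometric`**: for all `a b n`,
  `|D̂(n+2)_{ab} − limTwo_{ab}| ≤ rTwo^(n+1)·|c₀| + (n+1)·rTwo^n·(|c₁| + rTwo·|c₀|)` with `c₀ = (N(1+M̂0))_{ab}`, `c₁ = (N²(1+M̂0))_{ab}`;
  ★★ **`tendsto_hatD_two : D̂(k)_{ab} → limTwo_{ab}`** (numerically `limTwo = (0.1213, 0.2242, 0.3284, 0.5412 | 0.0657, 0.1213, 0.1777, 0.2929 | 0.2929, 0.5412,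
  0.7929, 1.3066 | 0.1777, 0.3284, 0.4812, 0.7929)`, the limits of #633 made explicit at width two).

Label: LANE THEOREM (own result of lane «pcv-sawmu», a-p2 g26, 2026-08-27; not in print).  NOT claimed: the contact sums `Ĉ`, `Ĉ²` (CAR V-C) and the variance
rate itself; any `T ≥ 3`.
-/

noncomputable section

open Finset Filter Topology Matrix Literature.Probability.LatticeModels Literature.Probability.Percolation

namespace Literature.Probability.RandomPlanarGeometry.SAW

namespace HV

namespace W2

/-! ### §1 `D̂(k) = G^k·(1 + M̂(0))` -/

/-- `D̂(0) = M̂(0)` at width two (renewal equation at `k = 0` and `M̂(0)² = 0`). [cite: Feller1968, XIII.3; lane «pcv-sawmu» a-p2 g26] -/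
theorem hatD_two_zero {y : ℝ} (hy : 0 ≤ y) : hatD 2 y 0 = hatMZeroTwo := by
  have hren := hat_ren (T := 2) hy 0
  rw [Finset.Nat.antidiagonal_zero, Finset.sum_singleton, hatM_two_zero] at hren
  simp only at hren
  -- hren : D̂0 = M̂0 + M̂0 D̂0 ⇒ (1 − M̂0) D̂0 = M̂0 ⇒ D̂0 = (1 + M̂0) M̂0 = M̂0
  have key : (1 + hatMZeroTwo) * (hatD 2 y 0 - hatMZeroTwo * hatD 2 y 0) = hatD 2 y 0 := by
    rw [Matrix.mul_sub, Matrix.add_mul, Matrix.one_mul, Matrix.add_mul, Matrix.one_mul, ← Matrix.mul_assoc, hatMZeroTwo_mul_self, Matrix.zero_mul]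
    abel
  have hsub : hatD 2 y 0 - hatMZeroTwo * hatD 2 y 0 = hatMZeroTwo := by
    rw [sub_eq_iff_eq_add']; rw [add_comm]; exact hren
  rw [← key, hsub, Matrix.add_mul, Matrix.one_mul, hatMZeroTwo_mul_self, add_zero]

/-- `D̂(1) = G·(1 + M̂(0))` at width two. [cite: Feller1968, XIII.3; lane «pcv-sawmu» a-p2 g26] -/
theorem hatD_two_one {y : ℝ} (hy : 0 ≤ y) : hatD 2 y 1 = gTwo y * (1 + hatMZeroTwo) := by
  have hren := hat_ren (T := 2) hy 1
  rw [Finset.Nat.sum_antidiagonal_succ, Finset.Nat.antidiagonal_zero, Finset.sum_singleton, hatM_two_one, hatM_two_zero, hatD_two_zero hy] at hren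
  simp only at hren
  -- hren : D̂1 = M̂1 + (M̂0 D̂1 + M̂1 M̂0)
  have key : (1 + hatMZeroTwo) * (hatD 2 y 1 - hatMZeroTwo * hatD 2 y 1) = hatD 2 y 1 := by
    rw [Matrix.mul_sub, Matrix.add_mul, Matrix.one_mul, Matrix.add_mul, Matrix.one_mul, ← Matrix.mul_assoc, hatMZeroTwo_mul_self, Matrix.zero_mul]
    abel
  have hsub : hatD 2 y 1 - hatMZeroTwo * hatD 2 y 1 = hatMOneTwo y * (1 + hatMZeroTwo) := by
    rw [Matrix.mul_add, Matrix.mul_one, sub_eq_iff_eq_add]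
    nth_rw 1 [hren]
    abel
  rw [← key, hsub, gTwo_eq, Matrix.mul_assoc]

/-- ★ **`D̂(k) = G^k·(1 + M̂(0))` for `k ≥ 1`** (every `y ≥ 0`). [cite: Stanley2012EC1, §4.1 Theorem 4.1.1; lane «pcv-sawmu» a-p2 g26 — own] -/
theorem hatD_two_eq_pow_mul {y : ℝ} (hy : 0 ≤ y) {k : ℕ} (hk : 1 ≤ k) : hatD 2 y k = gTwo y ^ k * (1
    + hatMZeroTwo) := by
  rw [hatD_two_eq_pow hy hk, hatD_two_one hy, ← Matrix.mul_assoc, ← pow_succ]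
  congr 2; omega

/-! ### §2 The spectral decomposition `G(y₂) = P + N` -/

/-- The rank-one spectral projection of `G(y₂)` onto the Perron direction: `P = uTwo ⊗ w/(w·uTwo)`, `w = ellTwo·(1 − M̂(0)) = (0, 1 − 2x², x − 3x³, 1)`,
`w·uTwo = 10 − 4x²`, entries reduced in `ℚ(x_c)`. [cite: Seneta1973, §1.4; lane «pcv-sawmu» a-p2 g26 — own computation] -/
def projTwo : Matrix (Fin (2 * 2)) (Fin (2 * 2)) ℝ :=
  Matrix.of ![![0, (1 : ℝ) * hexCriticalFugacity + (-2 : ℝ) * hexCriticalFugacity ^ 3, (3/2 : ℝ)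
      + (-5 : ℝ) * hexCriticalFugacity ^ 2, (1 : ℝ) * hexCriticalFugacity],
    ![0, (1 : ℝ) + (-3 : ℝ) * hexCriticalFugacity ^ 2, (3/2 : ℝ) * hexCriticalFugacity
        + (-5 : ℝ) * hexCriticalFugacity ^ 3, (1 : ℝ) * hexCriticalFugacity ^ 2],
    ![0, (1 : ℝ) * hexCriticalFugacity, (-1/2 : ℝ) + (2 : ℝ) * hexCriticalFugacity ^ 2, (3 : ℝ) * hexCriticalFugacity
        + (-2 : ℝ) * hexCriticalFugacity ^ 3],
    ![0, (3/2 : ℝ) + (-4 : ℝ) * hexCriticalFugacity ^ 2, (2 : ℝ) * hexCriticalFugacity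
        + (-13/2 : ℝ) * hexCriticalFugacity ^ 3, (1/2 : ℝ) + (1 : ℝ) * hexCriticalFugacity ^ 2]]

/-- The limit matrix `A = P·(1 + M̂(0))` of the hat bridge sums of `S₂` at criticality (e.g. `A₀₀ = 1 − 3x²`, `A₀₃ = x`, `A₂₂ = ½ + x²`).
[cite: Feller1968, XIII.10 (the renewal theorem: the limit); lane «pcv-sawmu» a-p2 g26 — own computation] -/
def limTwo : Matrix (Fin (2 * 2)) (Fin (2 * 2)) ℝ :=
  Matrix.of ![![(1 : ℝ) + (-3 : ℝ) * hexCriticalFugacity ^ 2, (1 : ℝ) * hexCriticalFugacity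
      + (-2 : ℝ) * hexCriticalFugacity ^ 3, (3/2 : ℝ)
      + (-4 : ℝ) * hexCriticalFugacity ^ 2, (1 : ℝ) * hexCriticalFugacity],
    ![(1 : ℝ) * hexCriticalFugacity + (-3 : ℝ) * hexCriticalFugacity ^ 3, (1 : ℝ)
        + (-3 : ℝ) * hexCriticalFugacity ^ 2, (3/2 : ℝ) * hexCriticalFugacity
        + (-4 : ℝ) * hexCriticalFugacity ^ 3, (1 : ℝ) * hexCriticalFugacity ^ 2],
    ![(1 : ℝ) * hexCriticalFugacity ^ 2, (1 : ℝ) * hexCriticalFugacity, (1/2 : ℝ)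
        + (1 : ℝ) * hexCriticalFugacity ^ 2, (3 : ℝ) * hexCriticalFugacity + (-2 : ℝ) * hexCriticalFugacity ^ 3],
    ![(3/2 : ℝ) * hexCriticalFugacity + (-4 : ℝ) * hexCriticalFugacity ^ 3, (3/2 : ℝ)
        + (-4 : ℝ) * hexCriticalFugacity ^ 2, (5/2 : ℝ) * hexCriticalFugacity
        + (-11/2 : ℝ) * hexCriticalFugacity ^ 3, (1/2 : ℝ) + (1 : ℝ) * hexCriticalFugacity ^ 2]]

/-- The trace coefficient of the subdominant quadratic of `G(y₂)`: `p = −(1 + x²)/7` (`= −2/7 + √2/14`). [cite: Stanley2012EC1, §4.1; lane «pcv-sawmu» a-p2 g26] -/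
def pTwo : ℝ := -1 / 7 - hexCriticalFugacity ^ 2 / 7

/-- The norm coefficient of the subdominant quadratic of `G(y₂)`: `κ = (2 − 5x²)/7` (`= −3/7 + 5√2/14 = 1/(6+5√2)`). [cite: Stanley2012EC1, §4.1; lane «pcv-sawmu» a-p2 g26] -/
def kTwo : ℝ := 2 / 7 - 5 * hexCriticalFugacity ^ 2 / 7

/-- `P² = P`. [cite: Seneta1973, §1.4; lane «pcv-sawmu» a-p2 g26 — own] -/
theorem projTwo_mul_self : projTwo * projTwo = projTwo := by
  have hP := xc_minpoly
  set x := hexCriticalFugacity with hx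
  ext a b
  fin_cases a <;> fin_cases b <;> simp [projTwo, Matrix.mul_apply, Fin.sum_univ_four, ← hx]
    <;> first | linear_combination | linear_combination ((3 : ℝ) * x) * hP | linear_combination ((-9/4 : ℝ)
        + (5 : ℝ) * x ^ 2) * hP | linear_combination ((4 : ℝ) * x) * hP | linear_combination ((-3/4 : ℝ) * x) * hP | linear_combination ((5 : ℝ) * x ^ 2) * hP | linear_combination ((3/4 : ℝ)
        + (13/2 : ℝ) * x ^ 2) * hP | linear_combination ((-3 : ℝ) * x) * hP | linear_combination ((3/4 : ℝ)) * hP | linear_combination ((1/4 : ℝ) * x) * hP | linear_combination ((-1/4 : ℝ)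
        + (13/2 : ℝ) * x ^ 2) * hP

/-- `G(y₂)·P = P`. [cite: Seneta1973, §1.4; lane «pcv-sawmu» a-p2 g26 — own] -/
theorem gTwo_mul_projTwo : gTwo (stripYT 2) * projTwo = projTwo := by
  have hP := xc_minpoly
  have hy := seven_mul_stripYT_two
  set x := hexCriticalFugacity with hx
  set y := stripYT 2 with hydef
  ext a b
  fin_cases a <;> fin_cases b <;> simp [projTwo, gTwo, Matrix.mul_apply, Fin.sum_univ_four, ← hx]
    <;> first | linear_combination | linear_combination ((-3/2 : ℝ)) * hP | linear_combination ((-1 : ℝ) * x) * hP | linear_combination ((-1 : ℝ)) * hP | linear_combination ((-3/2 : ℝ) * x) * hP | linear_combination ((-1 : ℝ) * x ^ 2) * hP | linear_combination ((32/7 : ℝ) * x) * hP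
        + ((3/14 : ℝ) * x + (-4/7 : ℝ) * x ^ 3) * hy | linear_combination ((1/2 : ℝ) + (52/7 : ℝ) * x ^ 2) * hP
        + ((2/7 : ℝ) * x ^ 2 + (-13/14 : ℝ) * x ^ 4) * hy | linear_combination ((-8/7 : ℝ) * x) * hP + ((1/14 : ℝ) * x
        + (1/7 : ℝ) * x ^ 3) * hy | linear_combination ((-3/2 : ℝ) + (32/7 : ℝ) * x ^ 2) * hP + ((3/14 : ℝ) * x ^ 2
        + (-4/7 : ℝ) * x ^ 4) * hy | linear_combination ((-2 : ℝ) * x + (52/7 : ℝ) * x ^ 3) * hP + ((2/7 : ℝ) * x ^ 3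
        + (-13/14 : ℝ) * x ^ 5) * hy | linear_combination ((-1/2 : ℝ) + (-8/7 : ℝ) * x ^ 2) * hP + ((1/14 : ℝ) * x ^ 2
        + (1/7 : ℝ) * x ^ 4) * hy

/-- `P·G(y₂) = P`. [cite: Seneta1973, §1.4; lane «pcv-sawmu» a-p2 g26 — own] -/
theorem projTwo_mul_gTwo : projTwo * gTwo (stripYT 2) = projTwo := by
  have hP := xc_minpoly
  have hy := seven_mul_stripYT_two
  set x := hexCriticalFugacity with hx
  set y := stripYT 2 with hydef
  ext a b
  fin_cases a <;> fin_cases b <;> simp [projTwo, gTwo, Matrix.mul_apply, Fin.sum_univ_four, ← hx]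
    <;> first | linear_combination | linear_combination ((-1 : ℝ) * x) * hP | linear_combination ((-3/2 : ℝ)
        + (-1 : ℝ) * x ^ 2) * hP | linear_combination ((32/7 : ℝ) * x) * hP + ((3/14 : ℝ) * x
        + (-4/7 : ℝ) * x ^ 3) * hy | linear_combination ((-1 : ℝ)) * hP | linear_combination ((-3/2 : ℝ) * x) * hP | linear_combination ((32/7 : ℝ) * x ^ 2) * hP
        + ((3/14 : ℝ) * x ^ 2
        + (-4/7 : ℝ) * x ^ 4) * hy | linear_combination ((1/2 : ℝ)) * hP | linear_combination ((-34/7 : ℝ) * x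
        + (16/7 : ℝ) * x ^ 3) * hP + ((-1/14 : ℝ) * x + (5/7 : ℝ) * x ^ 3
        + (-2/7 : ℝ) * x ^ 5) * hy | linear_combination ((-3/2 : ℝ)) * hP | linear_combination ((-2 : ℝ) * x) * hP | linear_combination ((-1/2 : ℝ)
        + (44/7 : ℝ) * x ^ 2) * hP + ((5/14 : ℝ) * x ^ 2 + (-11/14 : ℝ) * x ^ 4) * hy
set_option maxHeartbeats 400000 in
/-- ★ **`G³ + p·G² + κ·G = (1 + p + κ)·P` at `y₂`** (Cayley–Hamilton `G(G−1)(G² + pG + κ) = 0` resolved on the Perron direction: the range of `G³ + pG² + κG`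
is the `1`-eigenline). [cite: Stanley2012EC1, §4.1 Theorem 4.1.1 (iii); Seneta1973, §1.4; lane «pcv-sawmu» a-p2 g26 — own computation] -/
theorem gTwo_cubic_eq_proj :
    gTwo (stripYT 2) ^ 3 + pTwo • gTwo (stripYT 2) ^ 2 + kTwo • gTwo (stripYT 2) = (1 + pTwo + kTwo) • projTwo := by
  have hP := xc_minpoly
  have hy := seven_mul_stripYT_two
  set x := hexCriticalFugacity with hx
  set y := stripYT 2 with hydef
  ext a b
  fin_cases a <;> fin_cases b <;> simp [projTwo, gTwo, pTwo, kTwo, pow_succ, Matrix.add_apply, Matrix.smul_apply, ← hx]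
    <;> first | linear_combination | linear_combination ((-6/7 : ℝ) * x + (-8/7 : ℝ) * x ^ 3) * hP
        + ((1/7 : ℝ) * x ^ 5) * hy | linear_combination ((-12/7 : ℝ)
        + (3/7 : ℝ) * x ^ 2) * hP | linear_combination ((-8/7 : ℝ) * x + (-208/49 : ℝ) * x ^ 3
        + (128/49 : ℝ) * x ^ 5) * hP + ((-1/49 : ℝ) * x ^ 3 + (32/49 : ℝ) * x ^ 5 + (1/7 : ℝ) * x ^ 5 * y
        + (-16/49 : ℝ) * x ^ 7) * hy | linear_combination ((-8/7 : ℝ) + (-8/7 : ℝ) * x ^ 4) * hP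
        + ((1/7 : ℝ) * x ^ 6) * hy | linear_combination ((-12/7 : ℝ) * x
        + (3/7 : ℝ) * x ^ 3) * hP | linear_combination ((-8/7 : ℝ) * x ^ 2 + (-208/49 : ℝ) * x ^ 4
        + (128/49 : ℝ) * x ^ 6) * hP + ((-1/49 : ℝ) * x ^ 4 + (32/49 : ℝ) * x ^ 6 + (1/7 : ℝ) * x ^ 6 * y
        + (-16/49 : ℝ) * x ^ 8) * hy | linear_combination ((4/7 : ℝ) + (-3/7 : ℝ) * x ^ 2 + (-8/7 : ℝ) * x ^ 4) * hP
        + ((1/7 : ℝ) * x ^ 6) * hy | linear_combination ((-116/49 : ℝ) * x + (-3392/343 : ℝ) * x ^ 3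
        + (5760/343 : ℝ) * x ^ 5 + (-2048/343 : ℝ) * x ^ 7) * hP + ((2/49 : ℝ) * x + (-61/343 : ℝ) * x ^ 3
        + (-1/49 : ℝ) * x ^ 3 * y + (666/343 : ℝ) * x ^ 5 + (25/49 : ℝ) * x ^ 5 * y + (1/7 : ℝ) * x ^ 5 * y ^ 2
        + (-816/343 : ℝ) * x ^ 7 + (-16/49 : ℝ) * x ^ 7 * y
        + (256/343 : ℝ) * x ^ 9) * hy | linear_combination ((-12/7 : ℝ) + (-5/7 : ℝ) * x ^ 2 + (-208/49 : ℝ) * x ^ 4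
        + (128/49 : ℝ) * x ^ 6) * hP + ((-1/49 : ℝ) * x ^ 4 + (32/49 : ℝ) * x ^ 6 + (1/7 : ℝ) * x ^ 6 * y
        + (-16/49 : ℝ) * x ^ 8) * hy | linear_combination ((-16/7 : ℝ) * x + (-8/7 : ℝ) * x ^ 5) * hP
        + ((1/7 : ℝ) * x ^ 7) * hy | linear_combination ((-4/7 : ℝ) + (-95/49 : ℝ) * x ^ 2 + (-3784/343 : ℝ) * x ^ 4
        + (5760/343 : ℝ) * x ^ 6 + (-2048/343 : ℝ) * x ^ 8) * hP + ((2/49 : ℝ) * x ^ 2 + (-61/343 : ℝ) * x ^ 4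
        + (-1/49 : ℝ) * x ^ 4 * y + (715/343 : ℝ) * x ^ 6 + (25/49 : ℝ) * x ^ 6 * y + (1/7 : ℝ) * x ^ 6 * y ^ 2
        + (-816/343 : ℝ) * x ^ 8 + (-16/49 : ℝ) * x ^ 8 * y + (256/343 : ℝ) * x ^ 10) * hy

/-- `P·(1 + M̂(0)) = limTwo`. [cite: Feller1968, XIII.10; lane «pcv-sawmu» a-p2 g26] -/
theorem projTwo_mul_one_add : projTwo * (1 + hatMZeroTwo) = limTwo := by
  have hP := xc_minpoly
  set x := hexCriticalFugacity with hx
  ext a b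
  fin_cases a <;> fin_cases b <;> simp [projTwo, limTwo, hatMZeroTwo, Matrix.mul_apply, Matrix.add_apply, Fin.sum_univ_four, ← hx]
    <;> first | linear_combination | linear_combination ((-1 : ℝ)) * hP

/-- The subdominant part `N := G(y₂) − P`. [cite: Seneta1973, §1.4; lane «pcv-sawmu» a-p2 g26] -/
def nilTwo : Matrix (Fin (2 * 2)) (Fin (2 * 2)) ℝ := gTwo (stripYT 2) - projTwo

/-- `G(y₂)^(m+1)·P = P` for every `m` (plumbing). [cite: Seneta1973, §1.4; lane plumbing] -/
theorem gTwo_pow_mul_projTwo (m : ℕ) : gTwo (stripYT 2) ^ (m + 1) * projTwo = projTwo := by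
  induction m with
  | zero => rw [zero_add, pow_one, gTwo_mul_projTwo]
  | succ j hj => rw [pow_succ', Matrix.mul_assoc, hj, gTwo_mul_projTwo]

/-- `N^(k+1) = G(y₂)^(k+1) − P` for every `k` (from `P² = P`, `GP = PG = P`). [cite: Seneta1973, §1.4; lane «pcv-sawmu» a-p2 g26 — own] -/
theorem nilTwo_pow_succ (k : ℕ) : nilTwo ^ (k + 1) = gTwo (stripYT 2) ^ (k + 1) - projTwo := by
  induction k with
  | zero => simp [nilTwo]
  | succ n ih =>
    rw [pow_succ, ih, show (nilTwo : Matrix (Fin (2 * 2)) (Fin (2 * 2)) ℝ) = gTwo (stripYT 2) - projTwo from rfl, Matrix.sub_mul, Matrix.mul_sub,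
      Matrix.mul_sub, gTwo_pow_mul_projTwo, projTwo_mul_gTwo, projTwo_mul_self, ← pow_succ]
    abel

/-- ★ `G(y₂)^(k+1) = P + N^(k+1)` for every `k`. [cite: Seneta1973, §1.4; lane «pcv-sawmu» a-p2 g26 — own] -/
theorem gTwo_pow_succ_eq (k : ℕ) : gTwo (stripYT 2) ^ (k + 1) = projTwo + nilTwo ^ (k + 1) := by
  rw [nilTwo_pow_succ]; abel

/-- ★ **`N³ + p·N² + κ·N = 0`**: the subdominant part is annihilated by `λ(λ² + pλ + κ)`. [cite: Stanley2012EC1, §4.1 Theorem 4.1.1 (iii); lane «pcv-sawmu» a-p2 g26 — own] -/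
theorem nilTwo_cubic : nilTwo ^ 3 + pTwo • nilTwo ^ 2 + kTwo • nilTwo = 0 := by
  have h3 : nilTwo ^ 3 = gTwo (stripYT 2) ^ 3 - projTwo := by rw [gTwo_pow_succ_eq 2]; abel
  have h2 : nilTwo ^ 2 = gTwo (stripYT 2) ^ 2 - projTwo := by rw [gTwo_pow_succ_eq 1]; abel
  have h1 : nilTwo = gTwo (stripYT 2) - projTwo := rfl
  have hY := gTwo_cubic_eq_proj
  rw [h3, h2, h1, smul_sub, smul_sub]
  rw [add_smul, add_smul, one_smul] at hY
  have : gTwo (stripYT 2) ^ 3 - projTwo + (pTwo • gTwo (stripYT 2) ^ 2 - pTwo • projTwo)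
      + (kTwo • gTwo (stripYT 2) - kTwo • projTwo)
      = (gTwo (stripYT 2) ^ 3 + pTwo • gTwo (stripYT 2) ^ 2 + kTwo • gTwo (stripYT 2)) - (projTwo + pTwo • projTwo
          + kTwo • projTwo) := by abel
  rw [this, hY, sub_self]

/-- ★★★ **The hat bridge sums of `S₂` at criticality, decomposed: `D̂(k) = limTwo + N^k·(1 + M̂(0))` for `k ≥ 1`.**
[cite: Feller1968, XIII.10 (renewal theorem with remainder); Stanley2012EC1, §4.1 Theorem 4.1.1 (iii); lane «pcv-sawmu» a-p2 g26 — own result, not in print] -/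
theorem hatD_two_decomp {k : ℕ} (hk : 1 ≤ k) : hatD 2 (stripYT 2) k = limTwo + nilTwo ^ k * (1 + hatMZeroTwo) := by
  have hy0 : 0 ≤ stripYT 2 := (stripYT_pos (by norm_num)).le
  obtain ⟨m, rfl⟩ : ∃ m, k = m + 1 := ⟨k - 1, by omega⟩
  rw [hatD_two_eq_pow_mul hy0 hk, gTwo_pow_succ_eq m, Matrix.add_mul, projTwo_mul_one_add]

/-- The order-two recurrence of the subdominant term: with `s n := (N^(n+1)·(1 + M̂(0)))_{ab}`, `s (n+2) = −p·s (n+1) − κ·s n` for all `n`.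
[cite: Stanley2012EC1, §4.1 Theorem 4.1.1 (iii); lane «pcv-sawmu» a-p2 g26] -/
theorem nil_seq_rec (a b : Fin (2 * 2)) (n : ℕ) :
    (nilTwo ^ (n + 2 + 1) * (1 + hatMZeroTwo)) a b = -pTwo * (nilTwo ^ (n + 1 + 1) * (1
        + hatMZeroTwo)) a b - kTwo * (nilTwo ^ (n + 1) * (1 + hatMZeroTwo)) a b := by
  have hc := nilTwo_cubic
  have hmat : (nilTwo ^ (n + 2 + 1) + pTwo • nilTwo ^ (n + 1 + 1) + kTwo • nilTwo ^ (n + 1)) * (1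
      + hatMZeroTwo) = 0 := by
    rw [show nilTwo ^ (n + 2 + 1) = nilTwo ^ n * nilTwo ^ 3 by rw [← pow_add],
      show nilTwo ^ (n + 1 + 1) = nilTwo ^ n * nilTwo ^ 2 by rw [← pow_add],
      show nilTwo ^ (n + 1) = nilTwo ^ n * nilTwo by rw [pow_succ],
      ← Matrix.mul_smul, ← Matrix.mul_smul, ← Matrix.mul_add, ← Matrix.mul_add, hc, Matrix.mul_zero, Matrix.zero_mul]
  have h := congrFun (congrFun hmat a) b
  simp only [Matrix.add_mul, Matrix.smul_mul, Matrix.add_apply, Matrix.smul_apply, Matrix.zero_apply, smul_eq_mul] at h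
  linarith

/-! ### §3 Geometric convergence -/

/-- The geometric rate `R = quadRootBound p κ` (`= √κ = 1/√(6+5√2) = 0.2766`, since `p² − 4κ < 0`). [cite: Stanley2012EC1, §4.1; lane «pcv-sawmu» a-p2 g26] -/
def rTwo : ℝ := Literature.Analysis.quadRootBound pTwo kTwo

/-- `p² − 4κ < 0` (the subdominant eigenvalues are non-real) and `0 < κ < 1`, `|p| < 1`. [cite: Stanley2012EC1, §4.1; lane plumbing] -/
theorem pTwo_kTwo_facts : pTwo ^ 2 - 4 * kTwo < 0 ∧ 0 < kTwo ∧ kTwo < 1 ∧ |pTwo| < 1 := by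
  obtain ⟨h1, h2⟩ := xc_sq_bounds
  have hp : pTwo = -1 / 7 - hexCriticalFugacity ^ 2 / 7 := rfl
  have hk : kTwo = 2 / 7 - 5 * hexCriticalFugacity ^ 2 / 7 := rfl
  refine ⟨by rw [hp, hk]; nlinarith, by rw [hk]; linarith, by rw [hk]; linarith, ?_⟩
  rw [hp, abs_lt]; constructor <;> linarith

/-- ★ `rTwo < 1` (indeed `rTwo = √κ < 0.28`). [cite: Stanley2012EC1, §4.1; lane «pcv-sawmu» a-p2 g26] -/
theorem rTwo_lt_one : rTwo < 1 := by
  obtain ⟨hd, hk0, hk1, hp⟩ := pTwo_kTwo_facts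
  rw [rTwo, Literature.Analysis.quadRootBound]
  refine max_lt ?_ ?_
  · rw [Real.sqrt_eq_zero'.2 hd.le, add_zero]
    linarith
  · rw [show (1 : ℝ) = Real.sqrt 1 by simp]
    exact Real.sqrt_lt_sqrt hk0.le hk1

/-- ★★★ **Geometric convergence of the hat bridge sums of `S₂` at criticality** (explicit constants): for all levels `a, b` and every `n`,
`|D̂(n+2)_{ab} − limTwo_{ab}| ≤ rTwo^(n+1)·|c₀| + (n+1)·rTwo^n·(|c₁| + rTwo·|c₀|)`, `c₀ = (N·(1+M̂0))_{ab}`, `c₁ = (N²·(1+M̂0))_{ab}`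
(a-p5's deflation bound on the order-two recurrence `nil_seq_rec`). [cite: Feller1968, XIII.10 (geometric rate for finite support); Stanley2012EC1, §4.1 Theorem 4.1.1 (iii); lane «pcv-sawmu» a-p2 g26 — own result, not in print] -/
theorem hatD_two_geometric (a b : Fin (2 * 2)) (n : ℕ) :
    |hatD 2 (stripYT 2) (n + 2) a b - limTwo a b| ≤
      rTwo ^ (n + 1) * |(nilTwo * (1 + hatMZeroTwo)) a b|
        + ((n : ℝ) + 1) * rTwo ^ n * (|((nilTwo ^ 2 * (1 + hatMZeroTwo) : Matrix (Fin (2 * 2)) (Fin (2 * 2)) ℝ)) a b|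
            + rTwo * |(nilTwo * (1 + hatMZeroTwo)) a b|) := by
  set w : ℕ → ℝ := fun m => (nilTwo ^ (m + 1) * (1 + hatMZeroTwo)) a b with hw
  have hrec : ∀ m, w (m + 2) = -pTwo * w (m + 1) - kTwo * w m := fun m => nil_seq_rec a b m
  have hR0 : 0 ≤ rTwo := Literature.Analysis.quadRootBound_nonneg _ _
  have hR : ∀ σ : ℂ, σ ^ 2 + (pTwo : ℂ) * σ
      + (kTwo : ℂ) = 0 → ‖σ‖ ≤ rTwo := fun σ hσ => Literature.Analysis.norm_le_quadRootBound hσ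
  have h := Literature.Analysis.abs_le_of_rec_two hR0 hR hrec n
  have e : hatD 2 (stripYT 2) (n + 2) a b - limTwo a b = w (n + 1) := by
    rw [hatD_two_decomp (by omega : 1 ≤ n + 2), Matrix.add_apply, hw]
    ring
  rw [e]
  have e0 : w 0 = (nilTwo * (1 + hatMZeroTwo)) a b := by simp [hw]
  have e1 : w 1 = ((nilTwo ^ 2 * (1 + hatMZeroTwo) : Matrix (Fin (2 * 2)) (Fin (2 * 2)) ℝ)) a b := by simp [hw]
  rw [e0, e1] at h
  exact h

/-- ★★ **The hat bridge sums of `S₂` at criticality converge to the explicit matrix `limTwo`**: `D̂(k)_{ab} → limTwo_{ab}` for all `a, b`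
(`limTwo₀₀ = 1 − 3x² = 0.12132`, `limTwo₀₃ = x = 0.54120`, `limTwo₂₂ = ½ + x² = 0.79289`, …). [cite: Feller1968, XIII.10; lane «pcv-sawmu» a-p2 g26 — own result, not in print] -/
theorem tendsto_hatD_two (a b : Fin (2 * 2)) : Tendsto (fun k : ℕ => hatD 2 (stripYT 2) k a b) atTop (𝓝 (limTwo a b)) := by
  set w : ℕ → ℝ := fun m => (nilTwo ^ (m + 1) * (1 + hatMZeroTwo)) a b with hw
  have hrec : ∀ m, w (m + 2) = -pTwo * w (m + 1) - kTwo * w m := fun m => nil_seq_rec a b m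
  have hR0 : 0 ≤ rTwo := Literature.Analysis.quadRootBound_nonneg _ _
  have hR : ∀ σ : ℂ, σ ^ 2 + (pTwo : ℂ) * σ
      + (kTwo : ℂ) = 0 → ‖σ‖ ≤ rTwo := fun σ hσ => Literature.Analysis.norm_le_quadRootBound hσ
  have hw0 : Tendsto w atTop (𝓝 0) := Literature.Analysis.tendsto_zero_of_rec_two_of_lt_one hR0 rTwo_lt_one hR hrec
  -- D̂(m+2) = limTwo + w (m+1)
  have h2 : Tendsto (fun m : ℕ => hatD 2 (stripYT 2) (m + 2) a b) atTop (𝓝 (limTwo a b)) := by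
    have e : (fun m : ℕ => hatD 2 (stripYT 2) (m + 2) a b) = fun m => limTwo a b + w (m + 1) := by
      funext m
      rw [hatD_two_decomp (by omega : 1 ≤ m + 2), Matrix.add_apply, hw]
    rw [e]
    have := (hw0.comp (tendsto_add_atTop_nat 1)).const_add (limTwo a b)
    simpa using this
  exact (tendsto_add_atTop_iff_nat 2).1 h2

end W2

end HV

end Literature.Probability.RandomPlanarGeometry.SAW
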